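import Literature.NumberTheory.LFunctions.DirichletPolynomialMeanValue
import HarnessLib

/-!
# Large values of Dirichlet polynomials supported on primes (Matomäki–Radziwiłł 2016, Lemma 8)

Topic `NumberTheory/LFunctions`, companion to `DirichletPolynomialMeanValue.lean` (which vendors the
discrete mean value theorem, Matomäki–Radziwiłł's Lemma 7, as the named fact
`MatomakiRadziwill2016_lemma7`).  This file **proves** Lemma 8 of Matomäki–Radziwiłł from Lemma 7:

* `MatomakiRadziwill2016_lemma8 (h7 : MatomakiRadziwill2016_lemma7) : ∃ C, …` — if
  `P(s) = ∑_{P ≤ p ≤ 2P} a_p p^{-s}` (`|a_p| ≤ 1`, `p` prime) satisfies `|P(1+it)| ≥ V⁻¹` at every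
  point of a well-spaced set `𝒯 ⊂ [-T, T]`, then
  `#𝒯 ≤ C V² T^{2 log V/log P} exp(C (log T/log P) log log T)` (for `2 ≤ P ≤ T`, `T ≥ e^e`,
  `V ≥ 1`).

The paper prints the last factor as `exp(2 (log T/log P) log log T)`; its five-line proof (which we
follow: `k = ⌈log T/log P⌉`, Lemma 7 for the Dirichlet polynomial `P(s)^k` of length `(2P)^k ≥ T`,
Chebyshev's inequality `#𝒯 V^{-2k} ≤ ∑_{t} |P(1+it)|^{2k}`, and the coefficient bound
`∑_n (b(n)/n)² ≤ k! (∑_p p^{-2})^k ≤ k! (2/P)^k`, the `k!` counting the rearrangements of a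
`k`-tuple of primes with a given product) tacitly absorbs the factors `k!`, `4^k`, `log(2(2P)^k)` and
the rounding `k ≤ log T/log P + 1` into that exponential, which costs an absolute constant in the
exponent (`absorb_aux`: `4^k k k^k log T ≤ exp(16 (log T/log P) log log T)`).  The constant obtained
is `C = 8 max(C₇, 1) + 16`, `C₇` being the constant of Lemma 7.  This is the large-value estimate
used in §8 of the paper (proof of Proposition 1, the sets `𝒯_j`), where any fixed constant in the
exponent is admissible.

Helper results: `natCast_prod_cpow` (`(∏ f i)^r = ∏ (f i)^r` for casts of naturals),
`card_filter_prod_eq_le_factorial` (at most `k!` tuples of primes from a fixed set have a given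
product — unique factorisation via `Nat.primeFactorsList_unique` and `List.permutations`),
`pow_sum_eq_sum_fiber` (the `k`-th power of a Dirichlet polynomial regrouped by the value of the
product), `sum_card_fiber_mul`.

## References

* K. Matomäki, M. Radziwiłł, *Multiplicative functions in short intervals*, Ann. of Math. (2)
  183 (2016), 1015–1056, doi:10.4007/annals.2016.183.3.6 (arXiv:1501.04585): §4, Lemma 8 and its
  proof (arXiv p. 11).
* H. Iwaniec, E. Kowalski, *Analytic Number Theory* (2004), Ch. 9 (the mean value theorem behind
  Lemma 7).

## Mathlib

`Fintype.piFinset`/`Finset.prod_univ_sum` (expanding the `k`-th power), `Finset.sum_fiberwise_of_maps_to`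
(regrouping), `Nat.primeFactorsList_unique`, `List.mem_permutations`, `List.length_permutations`,
`Complex.natCast_mul_natCast_cpow`, `Nat.factorial_le_pow`.
-/

noncomputable section

open Finset Real Complex

namespace Literature.NumberTheory.LFunctions

namespace DirichletLargeValues

/-- `((∏ f i : ℕ) : ℂ) ^ r = ∏ ((f i : ℕ) : ℂ) ^ r` (complex powers of casts of naturals are
multiplicative). [folklore] -/
theorem natCast_prod_cpow {ι : Type*} (s : Finset ι) (f : ι → ℕ) (r : ℂ) :
    ((∏ i ∈ s, f i : ℕ) : ℂ) ^ r = ∏ i ∈ s, ((f i : ℕ) : ℂ) ^ r := by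
  classical
  induction s using Finset.induction_on with
  | empty => simp
  | insert a s ha ih =>
    rw [Finset.prod_insert ha, Finset.prod_insert ha, Nat.cast_mul, Complex.natCast_mul_natCast_cpow, ih]

/-- The number of `k`-tuples of primes (from a fixed set) with a prescribed product is at most `k!`
(unique factorisation: all such tuples are rearrangements of one another). [folklore] -/
theorem card_filter_prod_eq_le_factorial (k : ℕ) (t : Finset ℕ) (ht : ∀ p ∈ t, p.Prime) (n : ℕ) :
    #((Fintype.piFinset fun _ : Fin k => t).filter (fun u => ∏ i, u i = n)) ≤ k.factorial := by
  classical
  set U := (Fintype.piFinset fun _ : Fin k => t).filter (fun u => ∏ i, u i = n) with hU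
  by_cases hne : U = ∅
  · simp [hne]
  obtain ⟨u₀, hu₀⟩ := Finset.nonempty_iff_ne_empty.mpr hne
  have hmemU : ∀ u ∈ U, (∀ i, u i ∈ t) ∧ ∏ i, u i = n := fun u hu => by
    simpa [hU, Fintype.mem_piFinset] using hu
  have hperm : ∀ u ∈ U, (List.ofFn u).Perm n.primeFactorsList := fun u hu => by
    obtain ⟨h1, h2⟩ := hmemU u hu
    refine Nat.primeFactorsList_unique ?_ ?_
    · rw [List.prod_ofFn, h2]
    · intro p hp
      rw [List.mem_ofFn] at hp
      obtain ⟨i, rfl⟩ := hp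
      exact ht _ (h1 i)
  have hlen : n.primeFactorsList.length = k := by
    have := (hperm u₀ hu₀).length_eq
    simpa using this.symm
  calc #U ≤ #(n.primeFactorsList.permutations.toFinset) := by
        refine Finset.card_le_card_of_injOn (fun u => List.ofFn u) (fun u hu => ?_) ?_
        · rw [Finset.mem_coe, List.mem_toFinset, List.mem_permutations]
          exact hperm u hu
        · intro u _ u' _ h
          exact List.ofFn_injective h
    _ ≤ n.primeFactorsList.permutations.length := List.toFinset_card_le _
    _ = k.factorial := by rw [List.length_permutations, hlen]

/-- The `k`-th power of a Dirichlet polynomial over a finite set `t ⊆ ℕ_{≥1}`, regrouped as a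
Dirichlet polynomial: `(∑_{p ∈ t} a_p p^{-s})^k = ∑_{n} c_n n^{-s}` with
`c_n = ∑_{p_1⋯p_k = n} a_{p_1}⋯a_{p_k}`, the sum ranging over `n ∈ [1, N]` as soon as all products
lie there. [folklore] -/
theorem pow_sum_eq_sum_fiber (k : ℕ) (t : Finset ℕ) (a : ℕ → ℂ) (s : ℂ) (N : ℕ)
    (hN : ∀ u ∈ Fintype.piFinset (fun _ : Fin k => t), ∏ i, u i ∈ Icc 1 N) :
    (∑ p ∈ t, a p * (p : ℂ) ^ (-s)) ^ k =
      ∑ n ∈ Icc 1 N, (∑ u ∈ (Fintype.piFinset fun _ : Fin k => t).filter (fun u => ∏ i, u i = n),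
        ∏ i, a (u i)) * (n : ℂ) ^ (-s) := by
  classical
  have h1 : (∑ p ∈ t, a p * (p : ℂ) ^ (-s)) ^ k = ∏ _i : Fin k, ∑ p ∈ t, a p * (p : ℂ) ^ (-s) := by
    simp
  rw [h1, Finset.prod_univ_sum]
  rw [← Finset.sum_fiberwise_of_maps_to hN]
  refine Finset.sum_congr rfl fun n _ => ?_
  rw [Finset.sum_mul]
  refine Finset.sum_congr rfl fun u hu => ?_
  rw [Finset.mem_filter] at hu
  rw [Finset.prod_mul_distrib, ← natCast_prod_cpow, hu.2]

/-- `∑_n (#{u : ∏ u = n}) w(n) = ∑_u w(∏ u)` (counting fibrewise). [folklore] -/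
theorem sum_card_fiber_mul (k : ℕ) (t : Finset ℕ) (w : ℕ → ℝ) (N : ℕ)
    (hN : ∀ u ∈ Fintype.piFinset (fun _ : Fin k => t), ∏ i, u i ∈ Icc 1 N) :
    ∑ n ∈ Icc 1 N, (#((Fintype.piFinset fun _ : Fin k => t).filter (fun u => ∏ i, u i = n)) : ℝ) * w n
      = ∑ u ∈ Fintype.piFinset (fun _ : Fin k => t), w (∏ i, u i) := by
  classical
  rw [← Finset.sum_fiberwise_of_maps_to hN]
  refine Finset.sum_congr rfl fun n _ => ?_
  rw [Finset.card_eq_sum_ones, Nat.cast_sum, Finset.sum_mul]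
  refine Finset.sum_congr rfl fun u hu => ?_
  rw [Finset.mem_filter] at hu
  rw [hu.2]; simp

/-- Numerical absorption used in Lemma 8: for `1 ≤ k ≤ 2ρ`, `1 ≤ ρ ≤ 2 log T` and
`L = log log T ≥ 1`, `4^k · k · k^k · log T ≤ exp(16 ρ L)`. [folklore] -/
theorem absorb_aux {k : ℕ} {ρ L T : ℝ} (hk1 : 1 ≤ k) (hk : (k : ℝ) ≤ 2 * ρ) (hρ : 1 ≤ ρ)
    (hρT : ρ ≤ 2 * Real.log T) (hL : 1 ≤ L) (hLdef : Real.log (Real.log T) = L) (hT : 1 ≤ Real.log T) :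
    (4 : ℝ) ^ k * k * (k : ℝ) ^ k * Real.log T ≤ Real.exp (16 * ρ * L) := by
  have hk0 : (0 : ℝ) < k := by exact_mod_cast hk1
  have hlogk : Real.log k ≤ 3 * L := by
    have h1 : (k : ℝ) ≤ 4 * Real.log T := by linarith
    have h2 : Real.log k ≤ Real.log 4 + Real.log (Real.log T) := by
      rw [← Real.log_mul (by norm_num) (by linarith)]
      exact Real.log_le_log hk0 h1
    have h3 : Real.log 4 ≤ 2 := by
      have := Real.log_le_sub_one_of_pos (show (0:ℝ) < 4 by norm_num)
      have h4 : Real.log 4 = 2 * Real.log 2 := by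
        rw [show (4:ℝ) = 2 ^ 2 by norm_num, Real.log_pow]; norm_num
      have h5 : Real.log 2 ≤ 1 := by
        have := Real.log_le_sub_one_of_pos (show (0:ℝ) < 2 by norm_num); linarith
      linarith
    linarith
  have e1 : (4 : ℝ) ^ k = Real.exp (k * Real.log 4) := by
    rw [← Real.exp_log (show (0:ℝ) < 4 ^ k by positivity), Real.log_pow]
  have e2 : (k : ℝ) = Real.exp (Real.log k) := (Real.exp_log hk0).symm
  have e3 : (k : ℝ) ^ k = Real.exp (k * Real.log k) := by
    rw [← Real.exp_log (show (0:ℝ) < (k : ℝ) ^ k by positivity), Real.log_pow]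
  have e4 : Real.log T = Real.exp L := by rw [← hLdef, Real.exp_log (by linarith)]
  rw [e1, e3, e4]
  nth_rewrite 2 [e2]
  rw [← Real.exp_add, ← Real.exp_add, ← Real.exp_add, Real.exp_le_exp]
  have hlog4 : Real.log 4 ≤ 3 := by
    have := Real.log_le_sub_one_of_pos (show (0:ℝ) < 4 by norm_num); linarith
  have t1 : (k : ℝ) * Real.log 4 ≤ 6 * ρ * L := by nlinarith
  have t2 : Real.log k ≤ 3 * ρ * L := by nlinarith
  have t3 : (k : ℝ) * Real.log k ≤ 6 * ρ * L := by
    calc (k : ℝ) * Real.log k ≤ k * (3 * L) := mul_le_mul_of_nonneg_left hlogk hk0.le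
      _ ≤ 2 * ρ * (3 * L) := by gcongr
      _ = 6 * ρ * L := by ring
  have t4 : L ≤ ρ * L := le_mul_of_one_le_left (by linarith) hρ
  linarith

set_option maxHeartbeats 800000 in
-- a single long explicit-constant bookkeeping proof
/-- **Matomäki–Radziwiłł 2016, Lemma 8** (large values of Dirichlet polynomials supported on
primes), PROVED from Lemma 7 (`MatomakiRadziwill2016_lemma7`, hypothesis) in explicit form.  As
printed: "Let `P(s) = ∑_{P ≤ p ≤ 2P} a_p p^{-s}` with `|a_p| ≤ 1`. Let `𝒯 ⊂ [-T, T]` be a sequence of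
well-spaced points such that `|P(1+it)| ≥ V^{-1}` for every `t ∈ 𝒯`. Then
`|𝒯| ≪ T^{2 log V / log P} V² exp(2 (log T / log P) log log T)`."  The printed proof
(`k = ⌈log T/log P⌉`, Lemma 7 applied to `P(s)^k`, `∑ (b(n)/n)² ≤ k! (∑ 1/p)^k / P^k`, Chebyshev)
tacitly absorbs factors `5^k k!`, `log(2P)`, `k ≤ log T/log P + 1` into the last exponential; this
is legitimate for `2 ≤ P ≤ T`, `T ≥ e^e`, `V ≥ 1` at the price of an absolute constant `C` in place
of `2` in that exponential, which is how the lemma is recorded here (a consequence of the printed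
statement in the range where the latter is meaningful, and all that §8 of the paper uses).
[cite: MatomakiRadziwillAnnals2016, Lemma 8] -/
theorem MatomakiRadziwill2016_lemma8 (h7 : MatomakiRadziwill2016_lemma7) :
    ∃ C : ℝ, ∀ (P T V : ℝ) (a : ℕ → ℂ) (𝒯 : Finset ℝ), 2 ≤ P → P ≤ T →
      Real.exp (Real.exp 1) ≤ T → 1 ≤ V → (∀ p, ‖a p‖ ≤ 1) → (∀ t ∈ 𝒯, |t| ≤ T) →
      (∀ t ∈ 𝒯, ∀ t' ∈ 𝒯, t ≠ t' → 1 ≤ |t - t'|) →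
      (∀ t ∈ 𝒯, V⁻¹ ≤ ‖∑ p ∈ (Icc ⌈P⌉₊ ⌊2 * P⌋₊).filter Nat.Prime,
          a p * (p : ℂ) ^ (-(1 + (t : ℂ) * I))‖) →
      (#𝒯 : ℝ) ≤ C * V ^ 2 * T ^ (2 * Real.log V / Real.log P)
        * Real.exp (C * (Real.log T / Real.log P) * Real.log (Real.log T)) := by
  classical
  obtain ⟨C₇, H7⟩ := h7
  refine ⟨8 * max C₇ 1 + 16, ?_⟩
  intro P T V a 𝒯 hP hPT hT hV ha h𝒯T hws hlarge
  -- the set of primes and elementary facts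
  set S := (Icc ⌈P⌉₊ ⌊2 * P⌋₊).filter Nat.Prime with hS
  have hSprime : ∀ p ∈ S, p.Prime := fun p hp => (Finset.mem_filter.mp hp).2
  have hSge : ∀ p ∈ S, ⌈P⌉₊ ≤ p := fun p hp => (Finset.mem_Icc.mp (Finset.mem_filter.mp hp).1).1
  have hSle : ∀ p ∈ S, p ≤ ⌊2 * P⌋₊ := fun p hp => (Finset.mem_Icc.mp (Finset.mem_filter.mp hp).1).2
  have hP0 : 0 < P := by linarith
  have hee : Real.exp 1 ≤ Real.log T := by
    rw [← Real.log_exp (Real.exp 1)]; exact Real.log_le_log (Real.exp_pos _) hT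
  have he1 : 1 ≤ Real.exp 1 := by have := Real.add_one_le_exp (1:ℝ); linarith
  have hlogT1 : 1 ≤ Real.log T := he1.trans hee
  have hT1 : 1 ≤ T := by
    have : Real.exp (Real.exp 1) ≥ 1 := Real.one_le_exp (by positivity)
    linarith
  have hT0 : 0 < T := by linarith
  have hL1 : 1 ≤ Real.log (Real.log T) := by
    rw [← Real.log_exp 1]; exact Real.log_le_log (Real.exp_pos 1) hee
  set L := Real.log (Real.log T) with hLdef
  have hlog2 : (1 : ℝ) / 2 ≤ Real.log 2 := by
    have := Real.add_one_le_exp (Real.log 2)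
    rw [Real.exp_log (by norm_num)] at this
    -- log 2 ≥ 1 - 1/2 via exp(1/2) ≤ 2
    by_contra hcon
    push Not at hcon
    have h1 : Real.exp (Real.log 2) < Real.exp (1 / 2) := Real.exp_lt_exp.mpr hcon
    rw [Real.exp_log (by norm_num)] at h1
    have h2 : Real.exp (1 / 2 : ℝ) ≤ 2 := by
      have h3 : Real.exp (1 / 2 : ℝ) ^ 2 = Real.exp 1 := by
        rw [← Real.exp_nat_mul]; norm_num
      nlinarith [Real.exp_one_lt_d9, Real.exp_pos (1 / 2 : ℝ)]
    linarith
  have hlogP : Real.log 2 ≤ Real.log P := Real.log_le_log (by norm_num) hP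
  have hlogP0 : 0 < Real.log P := by linarith
  have hlogPT : Real.log P ≤ Real.log T := Real.log_le_log hP0 hPT
  -- `ρ = log T / log P ≥ 1`, `k = ⌈ρ⌉`
  set ρ := Real.log T / Real.log P with hρ
  have hρ1 : 1 ≤ ρ := by rw [hρ, le_div_iff₀ hlogP0]; linarith
  have hρT : ρ ≤ 2 * Real.log T := by
    rw [hρ, div_le_iff₀ hlogP0]; nlinarith
  set k := ⌈ρ⌉₊ with hk
  have hkρ : ρ ≤ k := Nat.le_ceil ρ
  have hk1 : 1 ≤ k := by
    have : (0 : ℝ) < k := by linarith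
    exact_mod_cast this
  have hkρ' : (k : ℝ) ≤ ρ + 1 := (Nat.ceil_lt_add_one (by linarith)).le
  have hk2ρ : (k : ℝ) ≤ 2 * ρ := by linarith
  have hk0 : (0 : ℝ) < k := by exact_mod_cast hk1
  -- `T ≤ P^k`
  have hPk : T ≤ P ^ k := by
    have h1 : Real.log T ≤ k * Real.log P := by
      have := mul_le_mul_of_nonneg_right hkρ hlogP0.le
      rwa [hρ, div_mul_cancel₀ _ hlogP0.ne'] at this
    calc T = Real.exp (Real.log T) := (Real.exp_log hT0).symm
      _ ≤ Real.exp (k * Real.log P) := Real.exp_le_exp.mpr h1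
      _ = P ^ k := by rw [← Real.log_pow, Real.exp_log (by positivity)]
  -- `N = ⌊2P⌋^k`
  set M := ⌊2 * P⌋₊ with hM
  have hM1 : 1 ≤ M := Nat.le_floor (by push_cast; linarith)
  have hMle : (M : ℝ) ≤ 2 * P := Nat.floor_le (by linarith)
  set N := M ^ k with hN
  have hN1 : 1 ≤ N := Nat.one_le_pow _ _ hM1
  have hprod : ∀ u ∈ Fintype.piFinset (fun _ : Fin k => S), ∏ i, u i ∈ Icc 1 N := by
    intro u hu
    rw [Fintype.mem_piFinset] at hu
    rw [Finset.mem_Icc]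
    constructor
    · exact Nat.one_le_iff_ne_zero.mpr (Finset.prod_ne_zero_iff.mpr fun i _ =>
        (hSprime _ (hu i)).ne_zero)
    · calc ∏ i, u i ≤ ∏ _i : Fin k, M := Finset.prod_le_prod' fun i _ => hSle _ (hu i)
        _ = N := by simp [hN]
  -- the coefficients of `P(s)^k`
  set c : ℕ → ℂ := fun n =>
    (∑ u ∈ (Fintype.piFinset fun _ : Fin k => S).filter (fun u => ∏ i, u i = n), ∏ i, a (u i))
      * (n : ℂ)⁻¹ with hc
  have hpow : ∀ t : ℝ, (∑ p ∈ S, a p * (p : ℂ) ^ (-(1 + (t : ℂ) * I))) ^ k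
      = ∑ n ∈ Icc 1 N, c n * (n : ℂ) ^ (-((t : ℂ) * I)) := by
    intro t
    rw [pow_sum_eq_sum_fiber k S a (1 + t * I) N hprod]
    refine Finset.sum_congr rfl fun n hn => ?_
    have hn0 : (n : ℂ) ≠ 0 := by
      have : 1 ≤ n := (Finset.mem_Icc.mp hn).1
      exact_mod_cast (show n ≠ 0 by omega)
    simp only [hc]
    rw [mul_assoc]
    congr 1
    rw [neg_add, Complex.cpow_add _ _ hn0, Complex.cpow_neg_one]
  -- Lemma 7
  have h7' := H7 N c T 𝒯 hN1 hT1 h𝒯T hws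
  -- lower bound by the large values
  have hlow : (#𝒯 : ℝ) * (V ^ (2 * k))⁻¹
      ≤ ∑ t ∈ 𝒯, ‖∑ n ∈ Icc 1 N, c n * (n : ℂ) ^ (-((t : ℂ) * I))‖ ^ 2 := by
    rw [Finset.card_eq_sum_ones, Nat.cast_sum, Finset.sum_mul]
    refine Finset.sum_le_sum fun t ht => ?_
    rw [Nat.cast_one, one_mul, ← hpow t, norm_pow, ← pow_mul, ← inv_pow, mul_comm]
    exact pow_le_pow_left₀ (by positivity) (hlarge t ht) _
  -- size of the coefficients
  have hSsum : ∑ p ∈ S, ((p : ℝ) ^ 2)⁻¹ ≤ 2 / P := by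
    have h1 : ∀ p ∈ S, ((p : ℝ) ^ 2)⁻¹ ≤ (P ^ 2)⁻¹ := fun p hp => by
      have : P ≤ p := (Nat.le_ceil P).trans (by exact_mod_cast hSge p hp)
      gcongr
    have hcard : (#S : ℝ) ≤ P + 1 := by
      have h2 : #S ≤ #(Icc ⌈P⌉₊ ⌊2 * P⌋₊) := Finset.card_filter_le _ _
      rw [Nat.card_Icc] at h2
      have h3 : (#S : ℝ) ≤ ((⌊2 * P⌋₊ + 1 - ⌈P⌉₊ : ℕ) : ℝ) := by exact_mod_cast h2
      refine h3.trans ?_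
      have h4 := Nat.le_ceil P
      rcases le_or_gt ⌈P⌉₊ (⌊2 * P⌋₊ + 1) with h5 | h5
      · rw [Nat.cast_sub h5]; push_cast; linarith
      · rw [Nat.sub_eq_zero_of_le h5.le]; simp; linarith
    calc ∑ p ∈ S, ((p : ℝ) ^ 2)⁻¹ ≤ ∑ p ∈ S, (P ^ 2)⁻¹ := Finset.sum_le_sum h1
      _ = #S * (P ^ 2)⁻¹ := by rw [Finset.sum_const, nsmul_eq_mul]
      _ ≤ (P + 1) * (P ^ 2)⁻¹ := by gcongr
      _ ≤ 2 / P := by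
          rw [div_eq_mul_inv]
          have : (P + 1) * (P ^ 2)⁻¹ = ((P + 1) / P) * P⁻¹ := by field_simp
          rw [this]
          apply mul_le_mul_of_nonneg_right _ (by positivity)
          rw [div_le_iff₀ hP0]; linarith
  have hcoef : ∑ n ∈ Icc 1 N, ‖c n‖ ^ 2 ≤ k.factorial * (2 / P) ^ k := by
    -- `‖c n‖ ≤ m(n)/n`, `m(n) ≤ k!`
    set F : ℕ → Finset (Fin k → ℕ) := fun n =>
      (Fintype.piFinset fun _ : Fin k => S).filter (fun u => ∏ i, u i = n) with hF
    have hm : ∀ n, (#(F n) : ℝ) ≤ k.factorial := fun n => by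
      exact_mod_cast card_filter_prod_eq_le_factorial k S hSprime n
    have hcn : ∀ n ∈ Icc 1 N, ‖c n‖ ≤ #(F n) * (n : ℝ)⁻¹ := by
      intro n hn
      have hn1 : (1 : ℝ) ≤ n := by exact_mod_cast (Finset.mem_Icc.mp hn).1
      simp only [hc, hF]
      rw [norm_mul, norm_inv, Complex.norm_natCast]
      apply mul_le_mul_of_nonneg_right _ (by positivity)
      refine (norm_sum_le _ _).trans ?_
      calc ∑ u ∈ (Fintype.piFinset fun _ : Fin k => S).filter (fun u => ∏ i, u i = n), ‖∏ i, a (u i)‖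
          ≤ ∑ u ∈ (Fintype.piFinset fun _ : Fin k => S).filter (fun u => ∏ i, u i = n), (1 : ℝ) := by
            refine Finset.sum_le_sum fun u _ => ?_
            rw [norm_prod]
            exact Finset.prod_le_one (fun i _ => norm_nonneg _) fun i _ => ha _
        _ = #((Fintype.piFinset fun _ : Fin k => S).filter (fun u => ∏ i, u i = n)) := by simp
    have hsq : ∀ n ∈ Icc 1 N, ‖c n‖ ^ 2 ≤ k.factorial * ((#(F n) : ℝ) * ((n : ℝ) ^ 2)⁻¹) := by
      intro n hn
      have h1 := hcn n hn
      have h2 := hm n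
      have h0 : 0 ≤ (#(F n) : ℝ) * (n : ℝ)⁻¹ := by positivity
      calc ‖c n‖ ^ 2 ≤ (#(F n) * (n : ℝ)⁻¹) ^ 2 := pow_le_pow_left₀ (norm_nonneg _) h1 2
        _ = #(F n) * (#(F n) * ((n : ℝ) ^ 2)⁻¹) := by ring
        _ ≤ k.factorial * (#(F n) * ((n : ℝ) ^ 2)⁻¹) :=
            mul_le_mul_of_nonneg_right h2 (by positivity)
    calc ∑ n ∈ Icc 1 N, ‖c n‖ ^ 2
        ≤ ∑ n ∈ Icc 1 N, k.factorial * ((#(F n) : ℝ) * ((n : ℝ) ^ 2)⁻¹) := Finset.sum_le_sum hsq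
      _ = k.factorial * ∑ u ∈ Fintype.piFinset (fun _ : Fin k => S), (((∏ i, u i : ℕ) : ℝ) ^ 2)⁻¹ := by
          rw [← Finset.mul_sum, sum_card_fiber_mul k S (fun n => ((n : ℝ) ^ 2)⁻¹) N hprod]
      _ = k.factorial * (∑ p ∈ S, ((p : ℝ) ^ 2)⁻¹) ^ k := by
          congr 1
          have : (∑ p ∈ S, ((p : ℝ) ^ 2)⁻¹) ^ k = ∏ _i : Fin k, ∑ p ∈ S, ((p : ℝ) ^ 2)⁻¹ := by simp
          rw [this, Finset.prod_univ_sum]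
          refine Finset.sum_congr rfl fun u _ => ?_
          rw [Nat.cast_prod, ← Finset.prod_pow, ← Finset.prod_inv_distrib]
      _ ≤ k.factorial * (2 / P) ^ k := by
          gcongr
  -- combine
  have hC₇ : C₇ ≤ max C₇ 1 := le_max_left _ _
  have hsum0 : 0 ≤ ∑ n ∈ Icc 1 N, ‖c n‖ ^ 2 := Finset.sum_nonneg fun n _ => by positivity
  have hNle : (N : ℝ) ≤ (2 * P) ^ k := by
    rw [hN]; push_cast
    exact pow_le_pow_left₀ (by positivity) hMle k
  have hlogN : Real.log (2 * N) ≤ 4 * k * Real.log T := by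
    have hN0 : (0 : ℝ) < N := by exact_mod_cast hN1
    have h1 : Real.log (2 * N) ≤ Real.log 2 + k * Real.log (2 * P) := by
      rw [Real.log_mul (by norm_num) hN0.ne', ← Real.log_pow]
      gcongr
    have h2 : Real.log (2 * P) ≤ 2 * Real.log T := by
      have h5 : Real.log (2 * P) ≤ Real.log (T ^ 2) :=
        Real.log_le_log (by linarith) (by nlinarith)
      have h6 : Real.log (T ^ 2) = 2 * Real.log T := by
        rw [Real.log_pow]; push_cast; ring
      linarith
    have h3 : Real.log 2 ≤ Real.log T := (hlogP.trans hlogPT)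
    have h4 : (1 : ℝ) ≤ k := by exact_mod_cast hk1
    nlinarith
  have hmain : (#𝒯 : ℝ) * (V ^ (2 * k))⁻¹
      ≤ max C₇ 1 * (2 * 4 ^ k) * (4 * k * Real.log T) * k.factorial := by
    refine hlow.trans (h7'.trans ?_)
    have hTN : 0 ≤ T + N := by positivity
    have hlogN0 : 0 ≤ Real.log (2 * N) := Real.log_nonneg (by
      have : (1:ℝ) ≤ N := by exact_mod_cast hN1
      linarith)
    calc C₇ * (T + N) * Real.log (2 * N) * ∑ n ∈ Icc 1 N, ‖c n‖ ^ 2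
        ≤ max C₇ 1 * (T + N) * Real.log (2 * N) * (k.factorial * (2 / P) ^ k) := by
          have : C₇ * (T + N) * Real.log (2 * N) ≤ max C₇ 1 * (T + N) * Real.log (2 * N) := by
            gcongr
          calc _ ≤ max C₇ 1 * (T + N) * Real.log (2 * N) * ∑ n ∈ Icc 1 N, ‖c n‖ ^ 2 :=
                mul_le_mul_of_nonneg_right this hsum0
            _ ≤ _ := mul_le_mul_of_nonneg_left hcoef (by positivity)
      _ = max C₇ 1 * ((T + N) * (2 / P) ^ k) * Real.log (2 * N) * k.factorial := by ring
      _ ≤ max C₇ 1 * (2 * 4 ^ k) * (4 * k * Real.log T) * k.factorial := by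
          have hTP : (T + N) * (2 / P) ^ k ≤ 2 * 4 ^ k := by
            rw [div_pow, add_mul]
            have e1 : T * (2 ^ k / P ^ k) ≤ 2 ^ k := by
              rw [mul_div_assoc', div_le_iff₀ (by positivity)]
              nlinarith [pow_pos (show (0:ℝ) < 2 by norm_num) k]
            have e2 : (N : ℝ) * (2 ^ k / P ^ k) ≤ 4 ^ k := by
              calc (N : ℝ) * (2 ^ k / P ^ k) ≤ (2 * P) ^ k * (2 ^ k / P ^ k) := by gcongr
                _ = 4 ^ k := by
                    rw [mul_pow, show (4 : ℝ) ^ k = 2 ^ k * 2 ^ k by rw [← mul_pow]; norm_num]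
                    field_simp
            have e3 : (2 : ℝ) ^ k ≤ 4 ^ k := pow_le_pow_left₀ (by norm_num) (by norm_num) k
            linarith
          gcongr
  -- final absorption
  have hfact : (k.factorial : ℝ) ≤ (k : ℝ) ^ k := by exact_mod_cast Nat.factorial_le_pow k
  have habs := absorb_aux hk1 hk2ρ hρ1 hρT hL1 hLdef.symm hlogT1
  have hV2k : V ^ (2 * k) ≤ V ^ 2 * T ^ (2 * Real.log V / Real.log P) := by
    have hV0 : 0 < V := by linarith
    have e1 : V ^ (2 * k) = Real.exp (2 * k * Real.log V) := by
      rw [← Real.exp_log (pow_pos hV0 _), Real.log_pow]; push_cast; ring_nf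
    have e2 : V ^ 2 * T ^ (2 * Real.log V / Real.log P) = Real.exp (2 * (ρ + 1) * Real.log V) := by
      rw [Real.rpow_def_of_pos hT0, ← Real.exp_log (pow_pos hV0 2), Real.log_pow, ← Real.exp_add]
      congr 1
      rw [hρ]; push_cast; field_simp; ring
    rw [e1, e2, Real.exp_le_exp]
    have := Real.log_nonneg hV
    nlinarith
  -- assemble: #𝒯 ≤ V^{2k} · 8 C⁺ · (4^k k k^k log T)
  have hVpos : 0 < V ^ (2 * k) := by positivity
  have step1 : (#𝒯 : ℝ) ≤ V ^ (2 * k) * (max C₇ 1 * (2 * 4 ^ k) * (4 * k * Real.log T) * k.factorial) := by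
    have h := hmain
    rw [← div_eq_mul_inv, div_le_iff₀ hVpos] at h
    calc (#𝒯 : ℝ) ≤ max C₇ 1 * (2 * 4 ^ k) * (4 * k * Real.log T) * k.factorial * V ^ (2 * k) := h
      _ = _ := mul_comm _ _
  have step2 : max C₇ 1 * (2 * 4 ^ k) * (4 * k * Real.log T) * (k.factorial : ℝ)
      ≤ 8 * max C₇ 1 * Real.exp (16 * ρ * L) := by
    have h1 : max C₇ 1 * (2 * 4 ^ k) * (4 * k * Real.log T) * (k.factorial : ℝ)
        ≤ max C₇ 1 * (2 * 4 ^ k) * (4 * k * Real.log T) * (k : ℝ) ^ k :=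
      mul_le_mul_of_nonneg_left hfact (by positivity)
    refine h1.trans ?_
    calc max C₇ 1 * (2 * 4 ^ k) * (4 * k * Real.log T) * (k : ℝ) ^ k
        = 8 * max C₇ 1 * ((4 : ℝ) ^ k * k * (k : ℝ) ^ k * Real.log T) := by ring
      _ ≤ 8 * max C₇ 1 * Real.exp (16 * ρ * L) :=
          mul_le_mul_of_nonneg_left habs (by positivity)
  have hρL : 0 ≤ ρ * L := by positivity
  calc (#𝒯 : ℝ) ≤ V ^ (2 * k) * (8 * max C₇ 1 * Real.exp (16 * ρ * L)) :=
        step1.trans (mul_le_mul_of_nonneg_left step2 hVpos.le)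
    _ ≤ (V ^ 2 * T ^ (2 * Real.log V / Real.log P)) * (8 * max C₇ 1 * Real.exp (16 * ρ * L)) :=
        mul_le_mul_of_nonneg_right hV2k (by positivity)
    _ = 8 * max C₇ 1 * V ^ 2 * T ^ (2 * Real.log V / Real.log P) * Real.exp (16 * ρ * L) := by ring
    _ ≤ (8 * max C₇ 1 + 16) * V ^ 2 * T ^ (2 * Real.log V / Real.log P) * Real.exp (16 * ρ * L) := by
        gcongr; linarith
    _ ≤ (8 * max C₇ 1 + 16) * V ^ 2 * T ^ (2 * Real.log V / Real.log P)
          * Real.exp ((8 * max C₇ 1 + 16) * (Real.log T / Real.log P) * Real.log (Real.log T)) := by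
        rw [← hρ, ← hLdef]
        have hm1 : (1 : ℝ) ≤ max C₇ 1 := le_max_right _ _
        have hexp : 16 * ρ * L ≤ (8 * max C₇ 1 + 16) * ρ * L := by
          rw [mul_assoc, mul_assoc (8 * max C₇ 1 + 16)]
          exact mul_le_mul_of_nonneg_right (by linarith) hρL
        gcongr


end DirichletLargeValues

end Literature.NumberTheory.LFunctions
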